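import Summits.ValiantsHypothesis.ValiantsHypothesis.Theorems.LacunarySymmetroidMatrixDescartesWLawArrowLetters

/-!
# `MatrixDescartes` — line «finite» / «stamp»: the TWO-HUB ARROW DESIGN on the support `(0,1,4)` — letters, Schur form,
# determinant polynomial and degree (algebra behind the all-`m` theorem `FullyRealisable m ![0,1,4] (4m − 6)` of
# `…FiniteSectorLadderFour`)

HONEST FRAMING.  Object-search cell `pub-symmetroid`, seat val-sym-eng-3 g11 (census/instrument ENGINE #3 of D-0148 (b)).
HELPER of the crux item `stmt-ValiantsHypothesis-18050`
(`Summit.ValiantsHypothesis.ValiantsHypothesis.Theses.LacunarySymmetroid.MatrixDescartes`, asymptotic in `K`) with NO closure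
claim; no census constant is named here (pure matrix / polynomial bookkeeping).  Nothing here bears on the crux or on `VP ≠ VNP`.

THE DESIGN (size `M + 2`; an arrowhead whose centre `h₂` is placed LAST and whose `M + 1` leaves are indexed by `Fin (M+1)`:
leaf `0` is an AFFINE node `h₁`, leaves `1, …, M` are QUARTIC leaves; index `Fin (M+1) ⊕ Fin 1` reindexed to `Fin (M+2)` by
`finSumFinEquiv`; base `B > 0`).  Evaluated (`twoHubPencil_eval`), `S₀ + t S₁ + t⁴ S₂ = [[diag(a_i(t)), b(t)], [b(t)ᵀ, c(t)]]` with
* `a₀(t) = 1 − t/B^{11}` (the affine node), `a_{k+1}(t) = 1 + t⁴/B^{56(k+1)}` (quartic leaves, NO positive zero),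
* `b₀(t) = (1/B^{11} − 1/(2B^{14M+9})) t`, `b_{k+1}(t) = B/B^{7k} − t/B^{21k+12}` (vanishing at `t = B^{14k+13}`, the «dip»),
* `c(t) = −1 + (1/B^{14M+9} − 1/B^{11}) t`,
so that the hub block `C = [[a₀, b₀], [b₀, c]]` has `det C = a₀ c − b₀² = −(1 − t/(2B^{14M+9}))²` EXACTLY (a final dip) and the top
letter `S₂ = 0 ⊕ 0 ⊕ diag(1/B^{56(k+1)})` has rank `M = m − 2`.  By the arrowhead Schur complement (`WLawArrow.det_arrow`, reused)
and the split of leaf `0` (`twoHub_schur_split`), `det = (∏_k a_{k+1}) · g`,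
`g(t) = −(1 − t/(2B^{14M+9}))² + (t/B^{11} − 1)·∑_k H_k(t)`, `H_k = b_{k+1}²/a_{k+1} ≥ 0`; `arrow_prod_mul_schur` / `eval_twoHubPoly` /
`natDegree_twoHubPoly_le` give the determinant as an explicit polynomial of `natDegree ≤ 4M + 2`.  Located first in exact
arithmetic (`HOME/val-sym-eng-3/g11/tools/hub2_chain.py`: m = 4..8 realise 10, 14, 18, 22, 26).
[folklore] Schur complement of an arrowhead matrix; no citation is load-bearing.
-/

-- `Summit.ValiantsHypothesis.ValiantsHypothesis.…` repeats a component by the D-0017 layout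
-- (single-conjunct summit), which the `dupNamespace` linter flags; the name is mandated.
set_option linter.dupNamespace false

namespace Summit.ValiantsHypothesis.ValiantsHypothesis.Theorems.LacunarySymmetroidMatrixDescartes.FiniteSector

open scoped BigOperators Matrix
open Polynomial Finset Matrix
open Summit.ValiantsHypothesis.ValiantsHypothesis.Theorems.LacunarySymmetroidMatrixDescartes.WLawArrow
  (det_arrow isSymm_arrow)

/-! ## §1 The two-hub arrow pencil on `(0,1,4)`: letters, evaluation, symmetry, determinant, degree -/

/-- **The pencil of the two-hub arrow letters, evaluated.**  Size `M + 2`: an arrowhead with centre (the hub `h₂`) placed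
LAST and `M + 1` leaves indexed by `Fin (M+1)` — leaf `0` is the AFFINE node `h₁` (diagonal `1 − t/B^{11}`, border
`(1/B^{11} − 1/(2B^{14M+9})) t`), leaf `k+1` is the `k`-th QUARTIC leaf (diagonal `1 + t⁴/B^{56(k+1)}`, border
`B/B^{7k} − t/B^{21k+12}`); corner `−1 + (1/B^{14M+9} − 1/B^{11}) t`.  Index `Fin (M+1) ⊕ Fin 1` reindexed to `Fin (M+2)`.
[bookkeeping] -/
theorem twoHubPencil_eval (M : ℕ) (B t : ℝ) :
    (∑ l, t ^ (![0, 1, 4] : Fin 3 → ℕ) l •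
      (![Matrix.reindex finSumFinEquiv finSumFinEquiv
            (Matrix.fromBlocks (diagonal fun _ : Fin (M + 1) => (1 : ℝ))
              (Matrix.of fun (i : Fin (M + 1)) (_ : Fin 1) => Matrix.vecCons (0 : ℝ) (fun k : Fin M => B / B ^ (7 * (k : ℕ))) i)
              (Matrix.of fun (_ : Fin 1) (i : Fin (M + 1)) => Matrix.vecCons (0 : ℝ) (fun k : Fin M => B / B ^ (7 * (k : ℕ))) i)
              (Matrix.of fun (_ _ : Fin 1) => (-1 : ℝ))),
          Matrix.reindex finSumFinEquiv finSumFinEquiv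
            (Matrix.fromBlocks (diagonal (Matrix.vecCons (-(1 / B ^ 11)) (fun _ : Fin M => (0 : ℝ))))
              (Matrix.of fun (i : Fin (M + 1)) (_ : Fin 1) =>
                Matrix.vecCons (1 / B ^ 11 - 1 / (2 * B ^ (14 * M + 9))) (fun k : Fin M => -(1 / B ^ (21 * (k : ℕ) + 12))) i)
              (Matrix.of fun (_ : Fin 1) (i : Fin (M + 1)) =>
                Matrix.vecCons (1 / B ^ 11 - 1 / (2 * B ^ (14 * M + 9))) (fun k : Fin M => -(1 / B ^ (21 * (k : ℕ) + 12))) i)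
              (Matrix.of fun (_ _ : Fin 1) => 1 / B ^ (14 * M + 9) - 1 / B ^ 11)),
          Matrix.reindex finSumFinEquiv finSumFinEquiv
            (Matrix.fromBlocks (diagonal (Matrix.vecCons (0 : ℝ) (fun k : Fin M => 1 / B ^ (56 * ((k : ℕ) + 1)))))
              (Matrix.of fun (_ : Fin (M + 1)) (_ : Fin 1) => (0 : ℝ))
              (Matrix.of fun (_ : Fin 1) (_ : Fin (M + 1)) => (0 : ℝ))
              (Matrix.of fun (_ _ : Fin 1) => (0 : ℝ)))] : Fin 3 → Matrix (Fin (M + 1 + 1)) (Fin (M + 1 + 1)) ℝ) l)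
      = Matrix.reindex finSumFinEquiv finSumFinEquiv
          (Matrix.fromBlocks
            (diagonal fun i : Fin (M + 1) =>
              1 + Matrix.vecCons (-(1 / B ^ 11)) (fun _ : Fin M => (0 : ℝ)) i * t
                + Matrix.vecCons (0 : ℝ) (fun k : Fin M => 1 / B ^ (56 * ((k : ℕ) + 1))) i * t ^ 4)
            (Matrix.of fun (i : Fin (M + 1)) (_ : Fin 1) =>
              Matrix.vecCons (0 : ℝ) (fun k : Fin M => B / B ^ (7 * (k : ℕ))) i
                + Matrix.vecCons (1 / B ^ 11 - 1 / (2 * B ^ (14 * M + 9))) (fun k : Fin M => -(1 / B ^ (21 * (k : ℕ) + 12))) i * t)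
            (Matrix.of fun (_ : Fin 1) (i : Fin (M + 1)) =>
              Matrix.vecCons (0 : ℝ) (fun k : Fin M => B / B ^ (7 * (k : ℕ))) i
                + Matrix.vecCons (1 / B ^ 11 - 1 / (2 * B ^ (14 * M + 9))) (fun k : Fin M => -(1 / B ^ (21 * (k : ℕ) + 12))) i * t)
            (Matrix.of fun (_ _ : Fin 1) => -1 + (1 / B ^ (14 * M + 9) - 1 / B ^ 11) * t)) := by
  rw [Fin.sum_univ_three]
  simp only [Matrix.cons_val_zero, Matrix.cons_val_one, Matrix.cons_val_two, Matrix.head_cons,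
    Matrix.tail_cons, pow_zero, one_smul, pow_one]
  ext i j
  simp only [Matrix.reindex_apply, Matrix.add_apply, Matrix.smul_apply, Matrix.submatrix_apply, smul_eq_mul]
  rcases finSumFinEquiv.symm i with a | z <;> rcases finSumFinEquiv.symm j with a' | z'
  · simp only [Matrix.fromBlocks_apply₁₁, diagonal_apply]
    split_ifs with h
    · subst h
      refine Fin.cases ?_ (fun k => ?_) a
      · simp only [Matrix.cons_val_zero]; ring
      · simp only [Matrix.cons_val_succ]; ring
    · ring
  · simp only [Matrix.fromBlocks_apply₁₂, Matrix.of_apply]; ring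
  · simp only [Matrix.fromBlocks_apply₂₁, Matrix.of_apply]; ring
  · simp only [Matrix.fromBlocks_apply₂₂, Matrix.of_apply]; ring


/-- The three two-hub letters are symmetric (an arrowhead with diagonal leaf block). [bookkeeping] -/
theorem twoHubPencil_isSymm (M : ℕ) (B : ℝ) (l : Fin 3) :
    ((![Matrix.reindex finSumFinEquiv finSumFinEquiv
            (Matrix.fromBlocks (diagonal fun _ : Fin (M + 1) => (1 : ℝ))
              (Matrix.of fun (i : Fin (M + 1)) (_ : Fin 1) => Matrix.vecCons (0 : ℝ) (fun k : Fin M => B / B ^ (7 * (k : ℕ))) i)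
              (Matrix.of fun (_ : Fin 1) (i : Fin (M + 1)) => Matrix.vecCons (0 : ℝ) (fun k : Fin M => B / B ^ (7 * (k : ℕ))) i)
              (Matrix.of fun (_ _ : Fin 1) => (-1 : ℝ))),
          Matrix.reindex finSumFinEquiv finSumFinEquiv
            (Matrix.fromBlocks (diagonal (Matrix.vecCons (-(1 / B ^ 11)) (fun _ : Fin M => (0 : ℝ))))
              (Matrix.of fun (i : Fin (M + 1)) (_ : Fin 1) =>
                Matrix.vecCons (1 / B ^ 11 - 1 / (2 * B ^ (14 * M + 9))) (fun k : Fin M => -(1 / B ^ (21 * (k : ℕ) + 12))) i)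
              (Matrix.of fun (_ : Fin 1) (i : Fin (M + 1)) =>
                Matrix.vecCons (1 / B ^ 11 - 1 / (2 * B ^ (14 * M + 9))) (fun k : Fin M => -(1 / B ^ (21 * (k : ℕ) + 12))) i)
              (Matrix.of fun (_ _ : Fin 1) => 1 / B ^ (14 * M + 9) - 1 / B ^ 11)),
          Matrix.reindex finSumFinEquiv finSumFinEquiv
            (Matrix.fromBlocks (diagonal (Matrix.vecCons (0 : ℝ) (fun k : Fin M => 1 / B ^ (56 * ((k : ℕ) + 1)))))
              (Matrix.of fun (_ : Fin (M + 1)) (_ : Fin 1) => (0 : ℝ))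
              (Matrix.of fun (_ : Fin 1) (_ : Fin (M + 1)) => (0 : ℝ))
              (Matrix.of fun (_ _ : Fin 1) => (0 : ℝ)))] : Fin 3 → Matrix (Fin (M + 1 + 1)) (Fin (M + 1 + 1)) ℝ) l).IsSymm := by
  fin_cases l
  · exact (isSymm_arrow _ _ _).reindex _
  · exact (isSymm_arrow _ _ _).reindex _
  · exact (isSymm_arrow (Matrix.vecCons (0 : ℝ) (fun k : Fin M => 1 / B ^ (56 * ((k : ℕ) + 1)))) (fun _ => 0) 0).reindex _

/-- **Generic arrow bookkeeping**: for non-vanishing leaf entries, `(∏ a)(c − ∑ b_i²/a_i) = c ∏ a − ∑_i b_i² ∏_{j ≠ i} a_j`.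
[folklore] -/
theorem arrow_prod_mul_schur {N : ℕ} (a b : Fin N → ℝ) (c : ℝ) (ha : ∀ i, a i ≠ 0) :
    (∏ i, a i) * (c - ∑ i, b i ^ 2 / a i) = c * ∏ i, a i - ∑ i, b i ^ 2 * ∏ j ∈ univ.erase i, a j := by
  rw [mul_sub, mul_comm, Finset.mul_sum]
  congr 1
  refine Finset.sum_congr rfl fun i _ => ?_
  rw [← Finset.mul_prod_erase univ a (mem_univ i)]
  field_simp [ha i]

/-- **The two-hub Schur form.**  Splitting off the affine leaf `0` (`a = a₀ :: D`, `b = b₀ :: E`, `a₀ ≠ 0`):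
`(∏ a)(c − ∑ b_i²/a_i) = (∏_k D_k) · (a₀ c − b₀² − a₀ ∑_k E_k²/D_k)` (`a₀ ≠ 0`). [folklore] -/
theorem twoHub_schur_split {M : ℕ} (a₀ b₀ c : ℝ) (D E : Fin M → ℝ) (ha₀ : a₀ ≠ 0) :
    (∏ i, Matrix.vecCons a₀ D i) * (c - ∑ i, Matrix.vecCons b₀ E i ^ 2 / Matrix.vecCons a₀ D i)
      = (∏ k, D k) * (a₀ * c - b₀ ^ 2 - a₀ * ∑ k, E k ^ 2 / D k) := by
  rw [Fin.prod_univ_succ, Fin.sum_univ_succ]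
  simp only [Matrix.cons_val_zero, Matrix.cons_val_succ]
  field_simp
  ring

/-- **The two-hub polynomial evaluates to the expanded arrow form.** [bookkeeping] -/
theorem eval_twoHubPoly {N : ℕ} (c₀ c₁ : ℝ) (β τ b₀ b₁ : Fin N → ℝ) (t : ℝ) :
    ((C c₀ + C c₁ * X) * ∏ i : Fin N, (C 1 + C (β i) * X + C (τ i) * X ^ 4)
        - ∑ i : Fin N, (C (b₀ i) + C (b₁ i) * X) ^ 2 *
            ∏ j ∈ univ.erase i, (C 1 + C (β j) * X + C (τ j) * X ^ 4)).eval t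
      = (c₀ + c₁ * t) * ∏ i : Fin N, (1 + β i * t + τ i * t ^ 4)
          - ∑ i : Fin N, (b₀ i + b₁ i * t) ^ 2 * ∏ j ∈ univ.erase i, (1 + β j * t + τ j * t ^ 4) := by
  simp only [eval_sub, eval_mul, eval_add, eval_pow, eval_C, eval_X, eval_prod, eval_finsetSum]

/-- **Degree of the two-hub polynomial**: with an affine leaf `0` (`τ 0 = 0`) and `M` quartic leaves, `natDegree ≤ 4M + 2`.
[bookkeeping] -/
theorem natDegree_twoHubPoly_le (M : ℕ) (c₀ c₁ β₀ : ℝ) (τ' : Fin M → ℝ) (b₀ b₁ : Fin (M + 1) → ℝ) :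
    ((C c₀ + C c₁ * X) * ∏ i : Fin (M + 1),
          (C 1 + C (Matrix.vecCons β₀ (fun _ : Fin M => (0 : ℝ)) i) * X + C (Matrix.vecCons (0 : ℝ) τ' i) * X ^ 4)
        - ∑ i : Fin (M + 1), (C (b₀ i) + C (b₁ i) * X) ^ 2 *
            ∏ j ∈ univ.erase i,
              (C 1 + C (Matrix.vecCons β₀ (fun _ : Fin M => (0 : ℝ)) j) * X + C (Matrix.vecCons (0 : ℝ) τ' j) * X ^ 4)).natDegree
      ≤ 4 * M + 2 := by
  -- per-leaf degree bounds: leaf `0` is affine, the others quartic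
  set δ : Fin (M + 1) → ℕ := Matrix.vecCons 1 (fun _ : Fin M => 4) with hδ
  have hA : ∀ i : Fin (M + 1),
      (C 1 + C (Matrix.vecCons β₀ (fun _ : Fin M => (0 : ℝ)) i) * X + C (Matrix.vecCons (0 : ℝ) τ' i) * X ^ 4 : ℝ[X]).natDegree
        ≤ δ i := by
    refine Fin.cases ?_ (fun k => ?_)
    · simp only [Matrix.cons_val_zero, map_zero, zero_mul, add_zero, hδ]
      exact (natDegree_add_le _ _).trans (max_le (by simp) ((natDegree_C_mul_le _ _).trans natDegree_X_le))
    · simp only [Matrix.cons_val_succ, map_zero, zero_mul, add_zero, hδ]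
      exact (natDegree_add_le _ _).trans (max_le (by simp) ((natDegree_C_mul_le _ _).trans (by simp)))
  have hsumδ : ∑ i : Fin (M + 1), δ i = 1 + 4 * M := by
    rw [Fin.sum_univ_succ]; simp [hδ, mul_comm]
  have hlin : ∀ (a b : ℝ), (C a + C b * X : ℝ[X]).natDegree ≤ 1 := fun a b =>
    (natDegree_add_le _ _).trans (max_le (by simp) ((natDegree_C_mul_le _ _).trans natDegree_X_le))
  refine (natDegree_sub_le _ _).trans (max_le ?_ ?_)
  · refine natDegree_mul_le.trans ?_
    have h1 := hlin c₀ c₁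
    have h2 := (natDegree_prod_le univ _).trans (Finset.sum_le_sum fun i (_ : i ∈ univ) => hA i)
    rw [hsumδ] at h2
    omega
  · refine natDegree_sum_le_of_forall_le _ _ fun i _ => ?_
    refine natDegree_mul_le.trans ?_
    have h1 : ((C (b₀ i) + C (b₁ i) * X) ^ 2 : ℝ[X]).natDegree ≤ 2 :=
      natDegree_pow_le.trans (by have := hlin (b₀ i) (b₁ i); omega)
    have h2 := (natDegree_prod_le (univ.erase i) _).trans
      (Finset.sum_le_sum fun j (_ : j ∈ univ.erase i) => hA j)
    have h3 : δ i + ∑ j ∈ univ.erase i, δ j = 1 + 4 * M := by rw [Finset.add_sum_erase _ _ (mem_univ i), hsumδ]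
    have h4 : 1 ≤ δ i := by
      refine Fin.cases ?_ (fun k => ?_) i <;> simp [hδ]
    omega


end Summit.ValiantsHypothesis.ValiantsHypothesis.Theorems.LacunarySymmetroidMatrixDescartes.FiniteSector
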